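import Literature.Geometry.Kaehler.ComplexTorusHodgeGroupAlmostQSimpleRadical
import Literature.Geometry.Kaehler.ComplexTorusHodgeLieAlgebraRatProductDerivedSeries
import HarnessLib

/-!
# Moonen–Zarhin's Lemmas (3.4)∕(3.6) combined, for abelian varieties: with `Hg(X₂)` almost `ℚ`-simple and
# `Hg(X₁ × X₂) ≠ Hg(X₁) × Hg(X₂)`, `𝒜(X₂)` is ABELIAN and embeds in the centre `𝔷(𝒜(X₁))`, or SEMISIMPLE and is a quotient of
# the derived algebra `𝒟𝒜(X₁)`; hence `dim 𝒜(X₂) > max(dim 𝔷(𝒜(X₁)), dim 𝒟𝒜(X₁))` forces `Hg(X₁ × X₂) = Hg(X₁) × Hg(X₂)`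

Layer `Literature/Geometry/Kaehler`, namespace `Literature.Geometry.Kaehler.ComplexTorus`; lane `lit-hodgefound` (Track 2
foundations library), Layer A3/A4; prover seat `lit-hodgefound-p17` (generation 43, self-proposed row g43-#6, the synthesis of
g43-#1 `…ProductAlmostQSimpleFactor` (torus case: `𝒜(X₂) ↪ 𝔷(𝒜(X₁))`, splitting for `dim 𝔷(𝒜(X₁)) < dim 𝒜(X₂)`), g43-#3
`…HodgeLieAlgebraRatProductDerivedSeries` (`dim 𝒟ᵖ𝒜(X₂) ≤ dim 𝒟ᵖ𝒜(X₁)` along a finite `K₂`) and g43-#5 `…AlmostQSimpleRadical`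
(«an almost `ℚ`-simple Hodge group of an abelian variety is semisimple or a torus»)).  THEOREMS ONLY (no definition, no instance,
no notation, no named fact; D-0026 net debt 0).

For abelian varieties `X₁` (polarisation `η₁`) and `X₂` (polarisation `η₂`) with `Hg(X₂)` ALMOST `ℚ`-SIMPLE — in g43-#1's
Lie-algebra rendering `(hQ)` or g43-#2's `ℚ`-subgroup rendering `(hQ′)` — g43-#5 splits into Moonen–Zarhin's two cases:
`𝒜(X₂)` abelian (Lemma (3.6): «`Hg(X₂)` a `ℚ`-simple algebraic torus») or `𝒜(X₂)` semisimple (Lemma (3.4): «`𝔥𝔤(X₂)` a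
`ℚ`-simple Lie algebra» — here only ALMOST simple).  If moreover `Hg(X₁ × X₂) ≠ Hg(X₁) × Hg(X₂)`, then `K₂` is finite and
`𝒜(X₂)` is a quotient of `𝒜(X₁) = 𝔷(𝒜(X₁)) ⊕ 𝒟𝒜(X₁)` (reductive): in the torus case it embeds in `𝔷(𝒜(X₁))` (g43-#1), in the
semisimple case `𝒜(X₂) = 𝒟𝒜(X₂) = φ(𝒟𝒜(X₁))` is a quotient of the derived algebra (Bourbaki I §1 no. 5 Prop. 4).

## Sources, verbatim

* B. Moonen, Yu. G. Zarhin [MoonenZarhin1999LowDim], Math. Ann. 315 (1999), §3 Lemma (3.4) (arXiv v2 = Math. Ann. numbering; earlier tree copies of this family wrote «Lemma (3.5)», which is Borovoi’s Remark) and its proof («we then have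
  `𝔥𝔤(X) = 𝔤₁ ⊕ 𝔤₃ ≅ 𝔥𝔤(X₁)` and `𝔥𝔤(X₂) ≅ 𝔤₃`»), Lemma (3.6) («then the center of `Hg(X₁)` contains an algebraic torus which is
  `ℚ`-isogenous to `Hg(X₂)`») (held `paper:arxiv-math_9901113` p0006 L131 – p0007 L25).
* N. Bourbaki [Bourbaki1989LieGroups13], Ch. I §1 no. 5 Prop. 4 («`f(𝒟ᵖ𝔤) = 𝒟ᵖ𝔥`»), §6 no. 4 (reductive: `𝔤 = 𝔷 × 𝒟𝔤`,
  `𝒟𝔤` semisimple).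
* B. B. Gordon [Gordon1997], §2.5.2 Corollary, §2.16 Proposition.  T. A. Springer [Springer1998], 4.4.5–4.4.7, 6.4.14, 12.1.7 (d).

## What is proved (abelian varieties `X₁`, `X₂`)

* **`IsRiemannForm.isLieAbelian_and_exists_injective_or_isSemisimple_and_exists_surjective_of_ne_of_almostQSimple`** ∕ `…RatSimple`:
  non-split with `Hg(X₂)` almost `ℚ`-simple ⟹ (`𝒜(X₂)` abelian ∧ `𝒜(X₂) ↪ 𝔷(𝒜(X₁))`) ∨ (`𝒜(X₂)` semisimple ∧ `𝒟𝒜(X₁) ↠ 𝒜(X₂)`).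
* **`IsRiemannForm.hodgeGroupC_prod_eq_blockDiagProd_of_almostQSimple_of_finrank_center_lt_of_finrank_derivedSeries_lt`** ∕
  `…RatSimple` ∕ `IsAbelianVariety.…`: `dim 𝔷(𝒜(X₁)) < dim 𝒜(X₂)` and `dim 𝒟𝒜(X₁) < dim 𝒜(X₂)` ⟹ `Hg(X₁ × X₂)(ℂ) = Hg(X₁)(ℂ) × Hg(X₂)(ℂ)`;
  `finrank_hodgeGroupLieRat_le_max_of_ne_of_almostQSimple` (non-split ⟹ `dim 𝒜(X₂) ≤ max (dim 𝔷(𝒜(X₁))) (dim 𝒟𝒜(X₁))`).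
-/

noncomputable section

open Matrix Module Function LieAlgebra

namespace Literature.Geometry.Kaehler

namespace ComplexTorus

open Literature.NumberTheory.Automorphic (IsZConnected lieAlgebraGL)

section AbelianVarieties

variable {ι₁ ι₂ : Type*} [Fintype ι₁] [Fintype ι₂] [DecidableEq ι₁] [DecidableEq ι₂]
  {E₁ E₂ : Type*} [NormedAddCommGroup E₁] [NormedSpace ℂ E₁] [NormedAddCommGroup E₂] [NormedSpace ℂ E₂]
  {Φ₁ : (ι₁ → ℝ) ≃L[ℝ] E₁} {Φ₂ : (ι₂ → ℝ) ≃L[ℝ] E₂} {η₁ : E₁ [⋀^Fin 2]→L[ℝ] ℝ} {η₂ : E₂ [⋀^Fin 2]→L[ℝ] ℝ}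

/-- `dim_ℚ ⊤ = dim_ℚ L` for the top Lie ideal. [folklore] -/
private theorem finrank_top_lieIdeal₄₃ {L : Type*} [LieRing L] [LieAlgebra ℚ L] :
    finrank ℚ (⊤ : LieIdeal ℚ L) = finrank ℚ L := by
  rw [show finrank ℚ (⊤ : LieIdeal ℚ L) = finrank ℚ (⊤ : LieIdeal ℚ L).toSubmodule from rfl, LieSubmodule.top_toSubmodule,
    finrank_top]

section LieRendering

variable
  (hQ : ∀ M : Subgroup (GL ι₂ ℂ), IsZConnected M → M ≤ (hodgeGroupC Φ₂).map Matrix.SpecialLinearGroup.toGL →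
    (∀ g ∈ (hodgeGroupC Φ₂).map Matrix.SpecialLinearGroup.toGL, M.map (MulAut.conj g : GL ι₂ ℂ →* GL ι₂ ℂ) = M) →
      (lieAlgebraGL M : Set (Matrix ι₂ ι₂ ℂ)) = Submodule.span ℂ ((fun A : Matrix ι₂ ι₂ ℚ ↦ A.map ((↑) : ℚ → ℂ)) ''
        {A : Matrix ι₂ ι₂ ℚ | A.map ((↑) : ℚ → ℂ) ∈ lieAlgebraGL M}) →
        M = ⊥ ∨ M = (hodgeGroupC Φ₂).map Matrix.SpecialLinearGroup.toGL)
include hQ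

/-- **MOONEN–ZARHIN (3.4)∕(3.6) COMBINED, ABELIAN VARIETIES: `Hg(X₂)` almost `ℚ`-simple and `Hg(X₁ × X₂) ≠ Hg(X₁) × Hg(X₂)` ⟹
`𝒜(X₂)` is ABELIAN and embeds in `𝔷(𝒜(X₁))` («the center of `Hg(X₁)` contains an algebraic torus `ℚ`-isogenous to `Hg(X₂)`»), OR
`𝒜(X₂)` is SEMISIMPLE and a quotient of the derived algebra `𝒟𝒜(X₁)`** (`𝒜(X₂) = 𝒟𝒜(X₂) = φ(𝒟𝒜(X₁))` for the surjection
`φ : 𝒜(X₁) ↠ 𝒜(X₂)` along the finite `K₂`). [cite: MoonenZarhin1999LowDim, §3 Lemma (3.4), proof, and Lemma (3.6)]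
[cite: Bourbaki1989LieGroups13, Ch. I §1 no. 5 Prop. 4] [cite: Gordon1997, §2.5.2 Corollary and §2.16 Proposition] -/
theorem IsRiemannForm.isLieAbelian_and_exists_injective_or_isSemisimple_and_exists_surjective_of_ne_of_almostQSimple
    (hη₁ : IsRiemannForm Φ₁ η₁) (hη₂ : IsRiemannForm Φ₂ η₂)
    (hne : hodgeGroupC (prodPeriod Φ₁ Φ₂) ≠ blockDiagProd (hodgeGroupC Φ₁) (hodgeGroupC Φ₂)) :
    (IsLieAbelian (hodgeGroupLieRat Φ₂) ∧
        ∃ j : hodgeGroupLieRat Φ₂ →ₗ⁅ℚ⁆ LieAlgebra.center ℚ (hodgeGroupLieRat Φ₁), Injective j) ∨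
      (LieAlgebra.IsSemisimple ℚ (hodgeGroupLieRat Φ₂) ∧
        ∃ ψ : derivedSeries ℚ (hodgeGroupLieRat Φ₁) 1 →ₗ⁅ℚ⁆ hodgeGroupLieRat Φ₂, Surjective ψ) := by
  rcases hη₂.isSemisimple_hodgeGroupLieRat_or_isLieAbelian_of_almostQSimple hQ with hss | hab
  · right
    refine ⟨hss, ?_⟩
    obtain ⟨φ, hφ⟩ := ComplexTorus.exists_surjective_lieHom_hodgeGroupLieRat_of_ne_of_almostQSimple Φ₁ Φ₂ hQ hne
    have htop : derivedSeries ℚ (hodgeGroupLieRat Φ₂) 1 = ⊤ := (hη₂.isSemisimple_hodgeGroupLieRat_iff_derived_eq_top).1 hss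
    refine ⟨φ.comp (derivedSeries ℚ (hodgeGroupLieRat Φ₁) 1).incl, fun y ↦ ?_⟩
    have hy : y ∈ (derivedSeries ℚ (hodgeGroupLieRat Φ₁) 1).map φ := by
      rw [LieIdeal.derivedSeries_map_eq 1 hφ, htop]
      exact LieSubmodule.mem_top y
    obtain ⟨x, hx⟩ := LieIdeal.mem_map_of_surjective hφ hy
    exact ⟨x, hx⟩
  · left
    haveI := hab
    exact ⟨hab, hη₁.exists_injective_lieHom_center_hodgeGroupLieRat_of_ne_of_almostQSimple Φ₂ hQ hne⟩

/-- **Non-split with `Hg(X₂)` almost `ℚ`-simple ⟹ `dim 𝒜(X₂) ≤ max (dim 𝔷(𝒜(X₁))) (dim 𝒟𝒜(X₁))`** (abelian varieties).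
[cite: MoonenZarhin1999LowDim, §3 Lemma (3.4) and Lemma (3.6)] [cite: Bourbaki1989LieGroups13, Ch. I §1 no. 5 Prop. 4] -/
theorem IsRiemannForm.finrank_hodgeGroupLieRat_le_max_of_ne_of_almostQSimple (hη₁ : IsRiemannForm Φ₁ η₁) (hη₂ : IsRiemannForm Φ₂ η₂)
    (hne : hodgeGroupC (prodPeriod Φ₁ Φ₂) ≠ blockDiagProd (hodgeGroupC Φ₁) (hodgeGroupC Φ₂)) :
    finrank ℚ (hodgeGroupLieRat Φ₂) ≤ max (finrank ℚ (LieAlgebra.center ℚ (hodgeGroupLieRat Φ₁)))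
      (finrank ℚ (derivedSeries ℚ (hodgeGroupLieRat Φ₁) 1)) := by
  haveI := finite_hodgeGroupLieRat Φ₁
  haveI := finite_hodgeGroupLieRat Φ₂
  rcases hη₂.isSemisimple_hodgeGroupLieRat_or_isLieAbelian_of_almostQSimple hQ with hss | hab
  · have htop : derivedSeries ℚ (hodgeGroupLieRat Φ₂) 1 = ⊤ := (hη₂.isSemisimple_hodgeGroupLieRat_iff_derived_eq_top).1 hss
    have h := finrank_derivedSeries_hodgeGroupLieRat_le_of_finite_hodgeGroupCProdInr Φ₁ Φ₂
      (ComplexTorus.finite_hodgeGroupCProdInr_of_ne_of_almostQSimple Φ₁ Φ₂ hQ hne) 1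
    rw [htop, finrank_top_lieIdeal₄₃] at h
    exact h.trans (le_max_right _ _)
  · haveI := hab
    exact (hη₁.finrank_hodgeGroupLieRat_le_finrank_center_of_ne_of_almostQSimple Φ₂ hQ hne).trans (le_max_left _ _)

/-- **THE COMBINED SPLITTING CRITERION, ABELIAN VARIETIES: `Hg(X₂)` almost `ℚ`-simple, `dim 𝔷(𝒜(X₁)) < dim 𝒜(X₂)` and
`dim 𝒟𝒜(X₁) < dim 𝒜(X₂)` ⟹ `Hg(X₁ × X₂)(ℂ) = Hg(X₁)(ℂ) × Hg(X₂)(ℂ)`** (the torus case is excluded by the centre, the semisimple case by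
the derived algebra). [cite: MoonenZarhin1999LowDim, §3 Lemma (3.4) and Lemma (3.6)] [cite: Gordon1997, §2.16 Proposition]
[cite: Springer1998, 4.4.5–4.4.7] -/
theorem IsRiemannForm.hodgeGroupC_prod_eq_blockDiagProd_of_almostQSimple_of_finrank_center_lt_of_finrank_derivedSeries_lt
    (hη₁ : IsRiemannForm Φ₁ η₁) (hη₂ : IsRiemannForm Φ₂ η₂)
    (hz : finrank ℚ (LieAlgebra.center ℚ (hodgeGroupLieRat Φ₁)) < finrank ℚ (hodgeGroupLieRat Φ₂))
    (hd : finrank ℚ (derivedSeries ℚ (hodgeGroupLieRat Φ₁) 1) < finrank ℚ (hodgeGroupLieRat Φ₂)) :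
    hodgeGroupC (prodPeriod Φ₁ Φ₂) = blockDiagProd (hodgeGroupC Φ₁) (hodgeGroupC Φ₂) := by
  by_contra hne
  have h := hη₁.finrank_hodgeGroupLieRat_le_max_of_ne_of_almostQSimple hQ hη₂ hne
  rcases le_max_iff.1 h with h | h
  · exact absurd h (not_le.2 hz)
  · exact absurd h (not_le.2 hd)

/-- Real points of the combined criterion. [cite: MoonenZarhin1999LowDim, §3 Lemma (3.4) and Lemma (3.6)] -/
theorem IsRiemannForm.hodgeGroup_prod_eq_of_almostQSimple_of_finrank_center_lt_of_finrank_derivedSeries_lt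
    (hη₁ : IsRiemannForm Φ₁ η₁) (hη₂ : IsRiemannForm Φ₂ η₂)
    (hz : finrank ℚ (LieAlgebra.center ℚ (hodgeGroupLieRat Φ₁)) < finrank ℚ (hodgeGroupLieRat Φ₂))
    (hd : finrank ℚ (derivedSeries ℚ (hodgeGroupLieRat Φ₁) 1) < finrank ℚ (hodgeGroupLieRat Φ₂)) :
    hodgeGroup (prodPeriod Φ₁ Φ₂) = ((hodgeGroup Φ₁).prod (hodgeGroup Φ₂)).map (blockDiag ι₁ ι₂) :=
  hodgeGroup_prod_eq_of_hodgeGroupC_prod_eq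
    (hη₁.hodgeGroupC_prod_eq_blockDiagProd_of_almostQSimple_of_finrank_center_lt_of_finrank_derivedSeries_lt hQ hη₂ hz hd)

/-- **`D = B` ∕ stable nondegeneracy for the product** under the combined criterion, for stably nondegenerate abelian varieties `X₁`,
`X₂`. [cite: MoonenZarhin1999LowDim, §3 Lemma (3.4) and Lemma (3.6)] [cite: Gordon1997, §2.16 Proposition] -/
theorem IsRiemannForm.forall_divisorClasses_powPeriod_prod_eq_hodgeClasses_of_almostQSimple_of_finrank_center_lt_of_finrank_derivedSeries_lt
    (hη₁ : IsRiemannForm Φ₁ η₁) (hη₂ : IsRiemannForm Φ₂ η₂)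
    (hz : finrank ℚ (LieAlgebra.center ℚ (hodgeGroupLieRat Φ₁)) < finrank ℚ (hodgeGroupLieRat Φ₂))
    (hd : finrank ℚ (derivedSeries ℚ (hodgeGroupLieRat Φ₁) 1) < finrank ℚ (hodgeGroupLieRat Φ₂))
    (hX₁ : ∀ k p, divisorClasses (powPeriod Φ₁ k) p = hodgeClasses (powPeriod Φ₁ k) p)
    (hX₂ : ∀ k p, divisorClasses (powPeriod Φ₂ k) p = hodgeClasses (powPeriod Φ₂ k) p) :
    ∀ k p, divisorClasses (powPeriod (prodPeriod Φ₁ Φ₂) k) p = hodgeClasses (powPeriod (prodPeriod Φ₁ Φ₂) k) p :=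
  forall_divisorClasses_powPeriod_prod_eq_hodgeClasses_of_hodgeGroupC_prod_eq
    (hη₁.hodgeGroupC_prod_eq_blockDiagProd_of_almostQSimple_of_finrank_center_lt_of_finrank_derivedSeries_lt hQ hη₂ hz hd) hX₁ hX₂

end LieRendering

/-- **The `ℚ`-subgroup rendering `(hQ′)`: non-split ⟹ (`𝒜(X₂)` abelian ∧ `𝒜(X₂) ↪ 𝔷(𝒜(X₁))`) ∨ (`𝒜(X₂)` semisimple ∧ `𝒟𝒜(X₁) ↠ 𝒜(X₂)`).**
[cite: MoonenZarhin1999LowDim, §3 Lemma (3.4) and Lemma (3.6)] [cite: Milne2017, Def. 19.7] -/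
theorem IsRiemannForm.isLieAbelian_and_exists_injective_or_isSemisimple_and_exists_surjective_of_ne_of_almostRatSimple
    (hη₁ : IsRiemannForm Φ₁ η₁) (hη₂ : IsRiemannForm Φ₂ η₂)
    (hQ' : ∀ N : Subgroup (SpecialLinearGroup ι₂ ℂ), IsZariskiClosed N → IsAutStable N → N ≤ hodgeGroupC Φ₂ →
      (∀ g ∈ hodgeGroupC Φ₂, ∀ x ∈ N, g * x * g⁻¹ ∈ N) → (N : Set (SpecialLinearGroup ι₂ ℂ)).Finite ∨ N = hodgeGroupC Φ₂)
    (hne : hodgeGroupC (prodPeriod Φ₁ Φ₂) ≠ blockDiagProd (hodgeGroupC Φ₁) (hodgeGroupC Φ₂)) :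
    (IsLieAbelian (hodgeGroupLieRat Φ₂) ∧
        ∃ j : hodgeGroupLieRat Φ₂ →ₗ⁅ℚ⁆ LieAlgebra.center ℚ (hodgeGroupLieRat Φ₁), Injective j) ∨
      (LieAlgebra.IsSemisimple ℚ (hodgeGroupLieRat Φ₂) ∧
        ∃ ψ : derivedSeries ℚ (hodgeGroupLieRat Φ₁) 1 →ₗ⁅ℚ⁆ hodgeGroupLieRat Φ₂, Surjective ψ) :=
  hη₁.isLieAbelian_and_exists_injective_or_isSemisimple_and_exists_surjective_of_ne_of_almostQSimple
    (ComplexTorus.forall_eq_bot_or_eq_of_almostRatSimple Φ₂ hQ') hη₂ hne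

/-- **`(hQ′)`: `dim 𝔷(𝒜(X₁)) < dim 𝒜(X₂)` and `dim 𝒟𝒜(X₁) < dim 𝒜(X₂)` ⟹ `Hg(X₁ × X₂)(ℂ) = Hg(X₁)(ℂ) × Hg(X₂)(ℂ)`** (abelian varieties).
[cite: MoonenZarhin1999LowDim, §3 Lemma (3.4) and Lemma (3.6)] [cite: Milne2017, Def. 19.7] [cite: Gordon1997, §2.16 Proposition] -/
theorem IsRiemannForm.hodgeGroupC_prod_eq_blockDiagProd_of_almostRatSimple_of_finrank_center_lt_of_finrank_derivedSeries_lt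
    (hη₁ : IsRiemannForm Φ₁ η₁) (hη₂ : IsRiemannForm Φ₂ η₂)
    (hQ' : ∀ N : Subgroup (SpecialLinearGroup ι₂ ℂ), IsZariskiClosed N → IsAutStable N → N ≤ hodgeGroupC Φ₂ →
      (∀ g ∈ hodgeGroupC Φ₂, ∀ x ∈ N, g * x * g⁻¹ ∈ N) → (N : Set (SpecialLinearGroup ι₂ ℂ)).Finite ∨ N = hodgeGroupC Φ₂)
    (hz : finrank ℚ (LieAlgebra.center ℚ (hodgeGroupLieRat Φ₁)) < finrank ℚ (hodgeGroupLieRat Φ₂))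
    (hd : finrank ℚ (derivedSeries ℚ (hodgeGroupLieRat Φ₁) 1) < finrank ℚ (hodgeGroupLieRat Φ₂)) :
    hodgeGroupC (prodPeriod Φ₁ Φ₂) = blockDiagProd (hodgeGroupC Φ₁) (hodgeGroupC Φ₂) :=
  hη₁.hodgeGroupC_prod_eq_blockDiagProd_of_almostQSimple_of_finrank_center_lt_of_finrank_derivedSeries_lt
    (ComplexTorus.forall_eq_bot_or_eq_of_almostRatSimple Φ₂ hQ') hη₂ hz hd

/-- **Abelian varieties (`IsAbelianVariety`), `(hQ′)`: the combined criterion.** [cite: MoonenZarhin1999LowDim, §3 Lemma (3.4) and Lemma (3.6)]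
[cite: Gordon1997, §2.16 Proposition] -/
theorem IsAbelianVariety.hodgeGroupC_prod_eq_blockDiagProd_of_almostRatSimple_of_finrank_center_lt_of_finrank_derivedSeries_lt
    (hA₁ : IsAbelianVariety Φ₁) (hA₂ : IsAbelianVariety Φ₂)
    (hQ' : ∀ N : Subgroup (SpecialLinearGroup ι₂ ℂ), IsZariskiClosed N → IsAutStable N → N ≤ hodgeGroupC Φ₂ →
      (∀ g ∈ hodgeGroupC Φ₂, ∀ x ∈ N, g * x * g⁻¹ ∈ N) → (N : Set (SpecialLinearGroup ι₂ ℂ)).Finite ∨ N = hodgeGroupC Φ₂)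
    (hz : finrank ℚ (LieAlgebra.center ℚ (hodgeGroupLieRat Φ₁)) < finrank ℚ (hodgeGroupLieRat Φ₂))
    (hd : finrank ℚ (derivedSeries ℚ (hodgeGroupLieRat Φ₁) 1) < finrank ℚ (hodgeGroupLieRat Φ₂)) :
    hodgeGroupC (prodPeriod Φ₁ Φ₂) = blockDiagProd (hodgeGroupC Φ₁) (hodgeGroupC Φ₂) := by
  obtain ⟨η₁, hη₁⟩ := hA₁
  obtain ⟨η₂, hη₂⟩ := hA₂
  exact hη₁.hodgeGroupC_prod_eq_blockDiagProd_of_almostRatSimple_of_finrank_center_lt_of_finrank_derivedSeries_lt hη₂ hQ' hz hd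

end AbelianVarieties

end ComplexTorus

end Literature.Geometry.Kaehler
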